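import Summits.QuantumAdvantage.QuantumAdvantage.Theorems.SymplecticPurityGraphStateSpectrum
import Summits.QuantumAdvantage.QuantumAdvantage.Theorems.SymplecticPurityDlogGraphFlatWalshRange
import Summits.QuantumAdvantage.QuantumAdvantage.Theorems.SymplecticPurityDlogGraphFlatFlankA
import Summits.QuantumAdvantage.QuantumAdvantage.Theorems.SymplecticPurityDlogGraphFlatFlank
import Summits.QuantumAdvantage.QuantumAdvantage.Theorems.SymplecticPurityDlogGraphFlatBandA
import Summits.QuantumAdvantage.QuantumAdvantage.Theorems.SymplecticPurityDlogGraphFlatBandB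
import Summits.QuantumAdvantage.QuantumAdvantage.Theorems.SymplecticPurityDlogGraphFlatPopularDiff
import Summits.QuantumAdvantage.QuantumAdvantage.Theorems.SymplecticPurityDlogGraphFlatSpreadOfPD
import Literature.Combinatorics.Additive.SumProductFp
import Literature.Analysis.Fourier.DiscreteCantorFUPProofs
import Mathlib.Analysis.Fourier.ZMod

/-!
# Crux `DlogGraphFlat` (stmt-QuantumAdvantage-10732), line `Sketch_holder_energy` — proof SKELETON

The crux: for BHP-window primes `p` (`2ⁿ − 2^{⌊0.53n⌋} ≤ p < 2ⁿ`), primitive roots `g` and the NAF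
guard on `p − 1`, the unnormalised DLOG graph vector `v = Σ_{x<2ⁿ} |x⟩|gˣ mod p⟩` on `n + n` qubits
has `|⟨v|σ_S|v⟩| ≤ 2^{(1−δ)n}` for every Pauli string `S ≠ I`.

Composition (`DlogGraphFlat_of`, sorry-free modulo the registered `stub_he*` theorems below): exactly
as in line `Sketch` (whose sector-A chain, dictionary and range stub are LANDED and imported here),
the crux is `sector A ∧ (range bias) ∧ (twisted Walsh sums)`; this line supplies a SECOND back end
for the twisted Walsh sums `W(α,β) = Σ_{x<2ⁿ} (−1)^{α·x} F_β(gˣ mod p)` (idea card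
`Cruxes/DlogGraphFlat/Ideas/holder-energy-pairing.md`), the Hölder pairing across the character
expansion of `ℤ/N`, `N = p − 1`:

* `stub_hePairing` — `N⁴ |Σ_x a(x)s(x)|⁴ ≤ ‖𝓕a‖₁² ‖𝓕a‖₂² ‖𝓕s‖₄⁴` (DFT inversion + two Cauchy–Schwarz);
* `stub_heFourthMoment` — `‖𝓕s‖₄⁴ = N · Σ_{x₁+x₂=x₃+x₄} s s s s` (additive energy on `ℤ/N`);
* `stub_heEnergyTransport` — `x ↦ gˣ` is a group isomorphism `ℤ/(p−1) → 𝔽_pˣ`, so the additive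
  energy of `x ↦ F(gˣ)` IS the multiplicative energy `E×(F) = Σ_{y₁y₂=y₃y₄} F F F F` (uses primitivity);
* the x-side ℓ¹ budget `‖𝓕a_α‖₁ ≤ 256 (n+1) N (2+√2)^{n/4}` for EVERY mask `α`
  (`stub_heRieszBlock`: dyadic blocks of `[0,N)` are Riesz products; `stub_heTwoStep`: the EXACT
  two-step transfer constant `Σ_{r<4} |1±e((φ+r)/2)|·|1±e((φ+r)/4)| ≤ 4√(2+√2)` (Cauchy–Schwarz on
  `a√(1+b) + b√(1+a)`, `a² + b² = 1`); `stub_heTransferAvg`: dyadic averages of Riesz products grow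
  like `(2+√2)^{m/4}` per `m` digits; `stub_heMeshSampling`: sampling at the `N`-th roots of unity
  costs a constant — a purely discrete Gallagher/Marcinkiewicz–Zygmund argument on a fine dyadic mesh;
  `stub_heBudgetGlue`: bookkeeping);
* `stub_heMultEnergyFlat` — THE OPEN CORE of this line (g-free, α-free, one register, one function):
  `E×(F_β) ≤ C p^{2 + 1/10}` for window primes and every digit mask `β ≠ 0`, `F_β(y) = (−1)^{β·bits y}`;
* `stub_heSpine` — bookkeeping: with `‖𝓕a‖₂² = N²`, `|W| ≤ |Σ_{x<N}| + (2ⁿ − p + 1)` and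
  `log₂ √(2+√2) = 0.8858 < 0.9 = 1 − 1/10`, the five statements give `|W(α,β)| ≤ 2^{(1−δ)n}`.

Inputs used from the crux's disprover (`Disproof.lean`, cdisprove 2026-08-15, evidence notes):
`_false_without_window` is honoured twice (the tail `x ∈ [p−1, 2ⁿ)` and `β ≠ 0 ⇒ F_β` non-constant on
`[0,p)` only because `p > 2^{n−1}` — for `p ≤ 2^{n−1}` and `β` = top bit, `E× = p³`);
`_false_without_primitivity` is consumed by `stub_heEnergyTransport`; `_false_without_guard` is NOT
used by sector B (the guard enters only sector A's flank, landed). No refuted strengthening is approached.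
-/

set_option linter.dupNamespace false -- D-0017: single-problem summit ⇒ `QuantumAdvantage.QuantumAdvantage` by design

namespace Summit.QuantumAdvantage.QuantumAdvantage.Theorems.SymplecticPurity.HolderEnergy

open Finset Literature.Computability.QuantumComplexity Literature.Computability.Cryptography
open scoped Pointwise

/-! ### Sector A (LANDED chain of line `Sketch`, re-derived here under fresh names) -/

/-- Sector A′ = R4: multiplicative energy of translates of the signed-digit spread set, from the landed
𝔽_p sum–product chain (`exists_sum_product_constants` → `stub_dlogPopularDiff` → `stub_dlogSpreadOfPD`). -/
theorem spreadEnergy : ∃ κ : ℝ, 0 < κ ∧ ∃ C : ℝ, 0 < C ∧ ∀ (n p : ℕ), p.Prime →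
    2 ^ n ≤ 2 * p → ∀ b : QReg n, 2 * (Finset.univ.filter fun j => b j = true).card ≤ n →
    ∀ c : ZMod p,
    (((((Finset.univ.image fun u : QReg n => fun j => u j && b j) ×ˢ
          (Finset.univ.image fun u : QReg n => fun j => u j && b j)) ×ˢ
        ((Finset.univ.image fun u : QReg n => fun j => u j && b j) ×ˢ
          (Finset.univ.image fun u : QReg n => fun j => u j && b j))).filter fun q =>
        (c + ((Nat.ofBits b : ZMod p) - 2 * (Nat.ofBits q.1.1 : ZMod p))) *
          (c + ((Nat.ofBits b : ZMod p) - 2 * (Nat.ofBits q.2.2 : ZMod p))) =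
        (c + ((Nat.ofBits b : ZMod p) - 2 * (Nat.ofBits q.1.2 : ZMod p))) *
          (c + ((Nat.ofBits b : ZMod p) - 2 * (Nat.ofBits q.2.1 : ZMod p)))).card : ℝ)
      ≤ C * (2 : ℝ) ^ ((3 - κ) * ((Finset.univ.filter fun j => b j = true).card : ℝ)) :=
  stub_dlogSpreadOfPD (stub_dlogPopularDiff Literature.Combinatorics.Additive.exists_sum_product_constants)

/-- Sector A, band: `D(a,a') ≤ 2^{(1−δ)n}` in the band, from R4 by the landed `stub_dlogBandReduction`. -/
theorem diffBand : ∃ δ : ℝ, 0 < δ ∧ ∃ n₀ : ℕ, ∀ n ≥ n₀, ∀ p g : ℕ, p.Prime → p < 2 ^ n →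
    2 ^ n ≤ p + 2 ^ (53 * n / 100) → orderOf (g : ZMod p) = p - 1 →
    (∀ c : Fin (n + 1) → ℤ, (∀ i, c i = 0 ∨ c i = 1 ∨ c i = -1) →
      ∑ i, c i * 2 ^ (i : ℕ) = (p : ℤ) - 1 → n ≤ 8 * (Finset.univ.filter fun i => c i ≠ 0).card) →
    ∀ a : QReg n, a ≠ (fun _ => false) → ∀ a' : QReg n,
    n - n / 16 ≤ min (Finset.univ.filter fun i => a i = true).card
          (n - (Finset.univ.filter fun i => a i = true).card) +
        min (Finset.univ.filter fun j => a' j = true).card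
          (n - (Finset.univ.filter fun j => a' j = true).card) + 3 →
    ((Finset.univ.filter fun x : QReg n =>
        (fun i : Fin n => Bool.xor ((g ^ Nat.ofBits (fun j => Bool.xor (x j) (a j)) % p).testBit (i : ℕ))
          ((g ^ Nat.ofBits x % p).testBit (i : ℕ))) = a').card : ℝ)
      ≤ (2 : ℝ) ^ ((1 - δ) * (n : ℝ)) :=
  stub_dlogBandReduction spreadEnergy

/-! ### Sector B stubs of line `Sketch_holder_energy` -/

/-- **Stub B1 (provable): the Hölder pairing on `ℤ/N`, root-free form.** For `a, s : ℤ/N → ℂ`,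
`N⁴ |Σ_x a(x) s(x)|⁴ ≤ (Σ_k |𝓕a(k)|)² (Σ_k |𝓕a(k)|²) (Σ_k |𝓕s(k)|⁴)`: DFT inversion gives
`Σ_x a s = N⁻¹ Σ_k 𝓕s(k) 𝓕a(−k)`, then Cauchy–Schwarz twice
(`Σ|u||v| ≤ (Σ|u|)^{1/2}(Σ|u||v|²)^{1/2}`, `Σ|u||v|² ≤ (Σ|u|²)^{1/2}(Σ|v|⁴)^{1/2}`). -/
theorem stub_hePairing : ∀ (N : ℕ) [NeZero N] (a s : ZMod N → ℂ),
    (N : ℝ) ^ 4 * ‖∑ x : ZMod N, a x * s x‖ ^ 4 ≤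
      (∑ k : ZMod N, ‖ZMod.dft a k‖) ^ 2 * (∑ k : ZMod N, ‖ZMod.dft a k‖ ^ 2) *
        (∑ k : ZMod N, ‖ZMod.dft s k‖ ^ 4) := by
  sorry

/-- **Stub B2 (provable): fourth moment of the DFT = additive energy.** For real `s : ℤ/N → ℝ`,
`Σ_k |𝓕s(k)|⁴ = N · Σ_{x₁,x₂,x₃} s(x₁)s(x₂)s(x₃)s(x₁+x₂−x₃)` (expand `|𝓕s(k)|⁴` and use
orthogonality `Σ_k e(tk/N) = N·[t = 0]`, `Literature…sum_stdAddChar_mul`). -/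
theorem stub_heFourthMoment : ∀ (N : ℕ) [NeZero N] (s : ZMod N → ℝ),
    ∑ k : ZMod N, ‖ZMod.dft (fun x => (s x : ℂ)) k‖ ^ 4 =
      (N : ℝ) * ∑ x₁ : ZMod N, ∑ x₂ : ZMod N, ∑ x₃ : ZMod N,
        s x₁ * s x₂ * s x₃ * s (x₁ + x₂ - x₃) := by
  sorry

/-- **Stub B3 (provable): energy transport along the discrete logarithm.** If `g ∈ 𝔽_p` has order
`N = p − 1`, then `x ↦ gˣ` is a bijection `ℤ/N → 𝔽_pˣ` turning `x₁ + x₂ − x₃` into `y₁y₂y₃⁻¹`, so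
for every `F : 𝔽_p → ℝ` the additive energy sum of `x ↦ F(gˣ)` equals the multiplicative energy
sum of `F` over the units (the one place primitivity is used). -/
theorem stub_heEnergyTransport : ∀ (p : ℕ) [Fact (Nat.Prime p)] (N : ℕ) [NeZero N] (g : ZMod p),
    orderOf g = N → N = p - 1 → ∀ F : ZMod p → ℝ,
    ∑ x₁ : ZMod N, ∑ x₂ : ZMod N, ∑ x₃ : ZMod N,
        F (g ^ x₁.val) * F (g ^ x₂.val) * F (g ^ x₃.val) * F (g ^ (x₁ + x₂ - x₃).val) =
      ∑ y₁ : (ZMod p)ˣ, ∑ y₂ : (ZMod p)ˣ, ∑ y₃ : (ZMod p)ˣ,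
        F (y₁ : ZMod p) * F (y₂ : ZMod p) * F (y₃ : ZMod p) *
          F ((y₁ * y₂ * y₃⁻¹ : (ZMod p)ˣ) : ZMod p) := by
  sorry

/-- **Stub B4a (provable, exact constant): the two-step transfer inequality.** For every choice of
signs and every real `φ`, `Σ_{r<4} |1 ± e((φ+r)/2)|·|1 ±' e((φ+r)/4)| ≤ 4√(2+√2)`. With
`|1+e(t)| = 2|cos πt|`, `|1−e(t)| = 2|sin πt|` and `u = πφ/4` the sum is
`4(A·√(1+B) + B·√(1+A))` with `{A,B} = {|cos 2u|, |sin 2u|}`, and Cauchy–Schwarz gives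
`≤ 4√(A²+B²)√(2+A+B) ≤ 4√(2+√2)` (equality at `A = B`). -/
theorem stub_heTwoStep : ∀ (a a' : Bool) (φ : ℝ),
    ∑ r ∈ Finset.range 4,
      ‖(1 : ℂ) + (if a then -1 else 1) * Complex.exp (2 * Real.pi * Complex.I * (((φ + (r : ℝ)) / 2 : ℝ) : ℂ))‖ *
      ‖(1 : ℂ) + (if a' then -1 else 1) * Complex.exp (2 * Real.pi * Complex.I * (((φ + (r : ℝ)) / 4 : ℝ) : ℂ))‖
      ≤ 4 * Real.sqrt (2 + Real.sqrt 2) := by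
  sorry

/-- **Stub B4b (provable from B4a): dyadic averages of Riesz products.** For every sign pattern `σ`,
every `m` and every base point `φ`,
`Σ_{r<2^m} Π_{i<m} |1 ± e(2^i (φ+r)/2^m)| ≤ 2 · 2^m · (2+√2)^{m/4}`: peeling the top two scales
(`r = e + 2e' + 4r''`, 1-periodicity of the weights) bounds the level-`m` average by the two-step
constant `√(2+√2)` (B4a divided by 4) times the sup of the level-`(m−2)` averages; induction on `m`
(one leftover scale costs `≤ 2`). -/
theorem stub_heTransferAvg :
    (∀ (a a' : Bool) (φ : ℝ),
      ∑ r ∈ Finset.range 4,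
        ‖(1 : ℂ) + (if a then -1 else 1) * Complex.exp (2 * Real.pi * Complex.I * (((φ + (r : ℝ)) / 2 : ℝ) : ℂ))‖ *
        ‖(1 : ℂ) + (if a' then -1 else 1) * Complex.exp (2 * Real.pi * Complex.I * (((φ + (r : ℝ)) / 4 : ℝ) : ℂ))‖
        ≤ 4 * Real.sqrt (2 + Real.sqrt 2)) →
    ∀ (m : ℕ) (σ : ℕ → Bool) (φ : ℝ),
      ∑ r ∈ Finset.range (2 ^ m), ∏ i ∈ Finset.range m,
        ‖(1 : ℂ) + (if σ i then -1 else 1) *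
          Complex.exp (2 * Real.pi * Complex.I * (((2 : ℝ) ^ i * ((φ + (r : ℝ)) / (2 : ℝ) ^ m) : ℝ) : ℂ))‖
      ≤ 2 * (2 : ℝ) ^ m * (2 + Real.sqrt 2) ^ ((m : ℝ) / 4) := by
  sorry

/-- **Stub B4c (provable from B4b): sampling Riesz products at the `N`-th roots of unity — a discrete
Gallagher / Marcinkiewicz–Zygmund bound.** If `2^m ≤ 4N` then
`Σ_{k<N} Π_{i<m} |1 ± e(2^i k/N)| ≤ 256 · N · (2+√2)^{m/4}`. Proof on the dyadic mesh of level
`M` (`2^M ≥ max(2N, 4^{m+1})`): (i) rounding `k/N` down to the mesh costs `≤ π4^m 2^{−M} ≤ 1` per point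
(`|e(s)−e(t)| ≤ 2π|s−t|`, all factors `≤ 2`); (ii) the rounded points `u_k` are `B = ⌊2^M/N⌋` mesh steps
apart, so the discrete Sobolev inequality on the windows `{u_k + i/2^M : i < B}` gives
`Σ_k P(u_k) ≤ B⁻¹ Σ_{r<2^M} P(r/2^M) + Σ_{r<2^M} |P((r+1)/2^M) − P(r/2^M)|`; (iii) the first sum is
`2^{M−m}` level-`m` averages (B4b with base points `r'/2^{M−m}`): `≤ 2·2^M (2+√2)^{m/4}`, and
`2^M/B ≤ 2N`; (iv) telescoping `Π f_i(u+h) − Π f_i(u)` over the scales, `|f_j(u+h) − f_j(u)| ≤ 2π 2^j h`,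
and grouping the mesh by residues modulo `2^{M−j−1}` turns each `Σ_r A_j(r/2^M) B_j((r+1)/2^M)` into
(level-`j`, denominator `2^{j+1}`) × (level-`(m−j−1)`) averages, `≤ 4·2^M (2+√2)^{(m−1)/4}`; summing
`2π 2^j 2^{−M}` over `j < m` gives `≤ 32π N (2+√2)^{(m−1)/4}`. Total `≤ (4 + 74 + 1) N (2+√2)^{m/4}`. -/
theorem stub_heMeshSampling :
    (∀ (m : ℕ) (σ : ℕ → Bool) (φ : ℝ),
      ∑ r ∈ Finset.range (2 ^ m), ∏ i ∈ Finset.range m,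
        ‖(1 : ℂ) + (if σ i then -1 else 1) *
          Complex.exp (2 * Real.pi * Complex.I * (((2 : ℝ) ^ i * ((φ + (r : ℝ)) / (2 : ℝ) ^ m) : ℝ) : ℂ))‖
      ≤ 2 * (2 : ℝ) ^ m * (2 + Real.sqrt 2) ^ ((m : ℝ) / 4)) →
    ∀ (m N : ℕ) [NeZero N] (σ : ℕ → Bool), 2 ^ m ≤ 4 * N →
      ∑ k : ZMod N, ∏ i ∈ Finset.range m,
        ‖(1 : ℂ) + (if σ i then -1 else 1) *
          Complex.exp (2 * Real.pi * Complex.I * (((2 : ℝ) ^ i * ((k.val : ℝ) / (N : ℝ)) : ℝ) : ℂ))‖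
      ≤ 256 * (N : ℝ) * (2 + Real.sqrt 2) ^ ((m : ℝ) / 4) := by
  sorry

/-- **Stub B4d (provable): the DFT of a Walsh sign restricted to `[0,N)` is a sum of Riesz products.**
For `N < 2ⁿ` and a mask `α`, with `a(x) = (−1)^{α·bits(x)}` on `x < N`:
`|𝓕a(k)| ≤ Σ_{j<n} Π_{i<j} |1 + (−1)^{α_i} e(2^i θ_k)|`, `θ_k = (−k).val/N`
(`𝓕a(k) = Σ_{x<N} a(x) e(x θ_k)`; split `[0,N)` into the dyadic blocks `[M_j, M_j + 2^j)` of the binary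
digits of `N`, on which `a(M_j + y) = a(M_j) a(y)`; the block sum over `y < 2^j` factorises as the Riesz
product `Π_{i<j} (1 + (−1)^{α_i} e(2^iθ))`; blocks for unset digits are added as non-negative terms). -/
theorem stub_heRieszBlock : ∀ (n N : ℕ) [NeZero N], N < 2 ^ n → ∀ (α : QReg n) (k : ZMod N),
    ‖ZMod.dft (fun x : ZMod N =>
        ((∏ i : Fin n, (if α i && x.val.testBit (i : ℕ) then (-1 : ℝ) else 1) : ℝ) : ℂ)) k‖ ≤
      ∑ j ∈ Finset.range n, ∏ i ∈ Finset.range j,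
        ‖(1 : ℂ) + (if (if h : i < n then α ⟨i, h⟩ else false) then -1 else 1) *
          Complex.exp (2 * Real.pi * Complex.I *
            (((2 : ℝ) ^ i * (((-k).val : ℝ) / (N : ℝ)) : ℝ) : ℂ))‖ := by
  sorry

/-- **Stub B4 glue (provable, bookkeeping): the x-side ℓ¹ budget** `Σ_k |𝓕a_α(k)| ≤ 256 (n+1) N (2+√2)^{n/4}`
for every mask `α`, from B4d (swap the sums, reindex `k ↦ −k`) and B4c (each block `j < n` has
`2^j ≤ 2ⁿ ≤ 4N`; `(2+√2)^{j/4} ≤ (2+√2)^{n/4}`). -/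
theorem stub_heBudgetGlue :
    (∀ (n N : ℕ) [NeZero N], N < 2 ^ n → ∀ (α : QReg n) (k : ZMod N),
      ‖ZMod.dft (fun x : ZMod N =>
          ((∏ i : Fin n, (if α i && x.val.testBit (i : ℕ) then (-1 : ℝ) else 1) : ℝ) : ℂ)) k‖ ≤
        ∑ j ∈ Finset.range n, ∏ i ∈ Finset.range j,
          ‖(1 : ℂ) + (if (if h : i < n then α ⟨i, h⟩ else false) then -1 else 1) *
            Complex.exp (2 * Real.pi * Complex.I *
              (((2 : ℝ) ^ i * (((-k).val : ℝ) / (N : ℝ)) : ℝ) : ℂ))‖) →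
    (∀ (m N : ℕ) [NeZero N] (σ : ℕ → Bool), 2 ^ m ≤ 4 * N →
      ∑ k : ZMod N, ∏ i ∈ Finset.range m,
        ‖(1 : ℂ) + (if σ i then -1 else 1) *
          Complex.exp (2 * Real.pi * Complex.I * (((2 : ℝ) ^ i * ((k.val : ℝ) / (N : ℝ)) : ℝ) : ℂ))‖
      ≤ 256 * (N : ℝ) * (2 + Real.sqrt 2) ^ ((m : ℝ) / 4)) →
    ∀ (n N : ℕ) [NeZero N], N < 2 ^ n → 2 ^ n ≤ 4 * N → ∀ α : QReg n,
      ∑ k : ZMod N, ‖ZMod.dft (fun x : ZMod N =>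
          ((∏ i : Fin n, (if α i && x.val.testBit (i : ℕ) then (-1 : ℝ) else 1) : ℝ) : ℂ)) k‖ ≤
        256 * ((n : ℝ) + 1) * (N : ℝ) * (2 + Real.sqrt 2) ^ ((n : ℝ) / 4) := by
  sorry

/-- **Stub B5 (OPEN CORE of line `Sketch_holder_energy`): flat multiplicative energy of the digital
sign functions.** For window primes `p` (`2ⁿ − 2^{⌊0.53n⌋} ≤ p < 2ⁿ`, so `p > 2^{n−1}` and every
`F_β`, `β ≠ 0`, is non-constant on `[0,p)`) and every digit mask `β ≠ 0`, the signed multiplicative energy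
`E×(F_β) = Σ_{y₁y₂ = y₃y₄ in 𝔽_pˣ} F_β(y₁)F_β(y₂)F_β(y₃)F_β(y₄)`, `F_β(y) = Π_i (−1)^{β_i bit_i(y)}`, is
`≤ C p^{2 + 1/10}`. Equivalently `Σ_{χ mod p} |Σ_y F_β(y)χ(y)|⁴ ≤ C p^{3.1}`, or: the RMS over all
multipliers `λ` of the pair dilation correlation `Σ_y F_β(y)F_β(λy)` is `≤ √C p^{0.55}`. Random-sign level
is `E× ≈ 2p²`; measured `E×/p² ∈ [1.9, 7]` for all mask types, n ≤ 24 (card, kit j017495). Known: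
`θ = 2c₁(β)` (sup × L², closes masks with ℓ¹-light Walsh–Fourier spectrum); interval-type masks have
`θ = 0⁺` (Ayyad–Cochrane–Zheng). Heavy masks: open. -/
theorem stub_heMultEnergyFlat : ∃ C : ℝ, 0 < C ∧ ∃ n₀ : ℕ, ∀ n ≥ n₀, ∀ (p : ℕ) [Fact (Nat.Prime p)],
    p < 2 ^ n → 2 ^ n ≤ p + 2 ^ (53 * n / 100) → ∀ β : QReg n, β ≠ (fun _ => false) →
    ∑ y₁ : (ZMod p)ˣ, ∑ y₂ : (ZMod p)ˣ, ∑ y₃ : (ZMod p)ˣ,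
      (∏ i : Fin n, (if β i && (y₁ : ZMod p).val.testBit (i : ℕ) then (-1 : ℝ) else 1)) *
      (∏ i : Fin n, (if β i && (y₂ : ZMod p).val.testBit (i : ℕ) then (-1 : ℝ) else 1)) *
      (∏ i : Fin n, (if β i && (y₃ : ZMod p).val.testBit (i : ℕ) then (-1 : ℝ) else 1)) *
      (∏ i : Fin n, (if β i && ((y₁ * y₂ * y₃⁻¹ : (ZMod p)ˣ) : ZMod p).val.testBit (i : ℕ)
        then (-1 : ℝ) else 1))
      ≤ C * (p : ℝ) ^ ((21 : ℝ) / 10) := by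
  sorry

/-- **Stub B6 (provable, bookkeeping): the spine.** B1 + B2 + B3 + the ℓ¹ budget + B5 imply the twisted
Walsh bound of the crux (all `α ≠ 0`; the guard is not used): reindex `x : QReg n` by `m = ofBits x < 2ⁿ`
(`sum_qReg_eq_sum_range`), split off the tail `m ∈ [p−1, 2ⁿ)` (`≤ 2^{⌊0.53n⌋} + 1` unimodular terms),
identify `[0, p−1)` with `ℤ/N`, apply B1 with `a(x) = (−1)^{α·bits x}`, `s(x) = F_β(gˣ)`; Plancherel
(`sum_norm_sq_dft`) gives `‖𝓕a‖₂² = N²`, B2+B3+B5 give `‖𝓕s‖₄⁴ ≤ N·C·p^{2.1}`, the budget gives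
`‖𝓕a‖₁ ≤ 256(n+1)N(2+√2)^{n/4}`; with `2 + √2 ≤ 2^{179/100}` the main term is
`≤ K √(n+1) 2^{(3.995/4) n}` and `|W| ≤ 2^{(1−δ)n}` for `δ = 1/2000`, `n ≥ n₀`. -/
theorem stub_heSpine :
    (∀ (N : ℕ) [NeZero N] (a s : ZMod N → ℂ),
      (N : ℝ) ^ 4 * ‖∑ x : ZMod N, a x * s x‖ ^ 4 ≤
        (∑ k : ZMod N, ‖ZMod.dft a k‖) ^ 2 * (∑ k : ZMod N, ‖ZMod.dft a k‖ ^ 2) *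
          (∑ k : ZMod N, ‖ZMod.dft s k‖ ^ 4)) →
    (∀ (N : ℕ) [NeZero N] (s : ZMod N → ℝ),
      ∑ k : ZMod N, ‖ZMod.dft (fun x => (s x : ℂ)) k‖ ^ 4 =
        (N : ℝ) * ∑ x₁ : ZMod N, ∑ x₂ : ZMod N, ∑ x₃ : ZMod N,
          s x₁ * s x₂ * s x₃ * s (x₁ + x₂ - x₃)) →
    (∀ (p : ℕ) [Fact (Nat.Prime p)] (N : ℕ) [NeZero N] (g : ZMod p),
      orderOf g = N → N = p - 1 → ∀ F : ZMod p → ℝ,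
      ∑ x₁ : ZMod N, ∑ x₂ : ZMod N, ∑ x₃ : ZMod N,
          F (g ^ x₁.val) * F (g ^ x₂.val) * F (g ^ x₃.val) * F (g ^ (x₁ + x₂ - x₃).val) =
        ∑ y₁ : (ZMod p)ˣ, ∑ y₂ : (ZMod p)ˣ, ∑ y₃ : (ZMod p)ˣ,
          F (y₁ : ZMod p) * F (y₂ : ZMod p) * F (y₃ : ZMod p) *
            F ((y₁ * y₂ * y₃⁻¹ : (ZMod p)ˣ) : ZMod p)) →
    (∀ (n N : ℕ) [NeZero N], N < 2 ^ n → 2 ^ n ≤ 4 * N → ∀ α : QReg n,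
      ∑ k : ZMod N, ‖ZMod.dft (fun x : ZMod N =>
          ((∏ i : Fin n, (if α i && x.val.testBit (i : ℕ) then (-1 : ℝ) else 1) : ℝ) : ℂ)) k‖ ≤
        256 * ((n : ℝ) + 1) * (N : ℝ) * (2 + Real.sqrt 2) ^ ((n : ℝ) / 4)) →
    (∃ C : ℝ, 0 < C ∧ ∃ n₀ : ℕ, ∀ n ≥ n₀, ∀ (p : ℕ) [Fact (Nat.Prime p)],
      p < 2 ^ n → 2 ^ n ≤ p + 2 ^ (53 * n / 100) → ∀ β : QReg n, β ≠ (fun _ => false) →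
      ∑ y₁ : (ZMod p)ˣ, ∑ y₂ : (ZMod p)ˣ, ∑ y₃ : (ZMod p)ˣ,
        (∏ i : Fin n, (if β i && (y₁ : ZMod p).val.testBit (i : ℕ) then (-1 : ℝ) else 1)) *
        (∏ i : Fin n, (if β i && (y₂ : ZMod p).val.testBit (i : ℕ) then (-1 : ℝ) else 1)) *
        (∏ i : Fin n, (if β i && (y₃ : ZMod p).val.testBit (i : ℕ) then (-1 : ℝ) else 1)) *
        (∏ i : Fin n, (if β i && ((y₁ * y₂ * y₃⁻¹ : (ZMod p)ˣ) : ZMod p).val.testBit (i : ℕ)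
          then (-1 : ℝ) else 1))
        ≤ C * (p : ℝ) ^ ((21 : ℝ) / 10)) →
    ∃ δ : ℝ, 0 < δ ∧ ∃ n₀ : ℕ, ∀ n ≥ n₀, ∀ p g : ℕ, p.Prime → p < 2 ^ n →
    2 ^ n ≤ p + 2 ^ (53 * n / 100) → orderOf (g : ZMod p) = p - 1 →
    (∀ c : Fin (n + 1) → ℤ, (∀ i, c i = 0 ∨ c i = 1 ∨ c i = -1) →
      ∑ i, c i * 2 ^ (i : ℕ) = (p : ℤ) - 1 → n ≤ 8 * (Finset.univ.filter fun i => c i ≠ 0).card) →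
    ∀ β : QReg n, β ≠ (fun _ => false) → ∀ α : QReg n, α ≠ (fun _ => false) →
    |∑ x : QReg n, (∏ i : Fin n, (if α i && x i then (-1 : ℝ) else 1)) *
        (∏ i : Fin n, (if β i && (g ^ Nat.ofBits x % p).testBit (i : ℕ) then (-1 : ℝ) else 1))|
      ≤ (2 : ℝ) ^ ((1 - δ) * (n : ℝ)) := by
  sorry

/-- The x-side ℓ¹ budget (DERIVED: B4a–B4d + glue). -/
theorem l1Budget : ∀ (n N : ℕ) [NeZero N], N < 2 ^ n → 2 ^ n ≤ 4 * N → ∀ α : QReg n,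
    ∑ k : ZMod N, ‖ZMod.dft (fun x : ZMod N =>
        ((∏ i : Fin n, (if α i && x.val.testBit (i : ℕ) then (-1 : ℝ) else 1) : ℝ) : ℂ)) k‖ ≤
      256 * ((n : ℝ) + 1) * (N : ℝ) * (2 + Real.sqrt 2) ^ ((n : ℝ) / 4) :=
  stub_heBudgetGlue stub_heRieszBlock (stub_heMeshSampling (stub_heTransferAvg stub_heTwoStep))

/-- Sector B with `α ≠ 0` (DERIVED: the spine applied to B1, B2, B3, the budget and the open core B5). -/
theorem walshTwisted : ∃ δ : ℝ, 0 < δ ∧ ∃ n₀ : ℕ, ∀ n ≥ n₀, ∀ p g : ℕ, p.Prime → p < 2 ^ n →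
    2 ^ n ≤ p + 2 ^ (53 * n / 100) → orderOf (g : ZMod p) = p - 1 →
    (∀ c : Fin (n + 1) → ℤ, (∀ i, c i = 0 ∨ c i = 1 ∨ c i = -1) →
      ∑ i, c i * 2 ^ (i : ℕ) = (p : ℤ) - 1 → n ≤ 8 * (Finset.univ.filter fun i => c i ≠ 0).card) →
    ∀ β : QReg n, β ≠ (fun _ => false) → ∀ α : QReg n, α ≠ (fun _ => false) →
    |∑ x : QReg n, (∏ i : Fin n, (if α i && x i then (-1 : ℝ) else 1)) *
        (∏ i : Fin n, (if β i && (g ^ Nat.ofBits x % p).testBit (i : ℕ) then (-1 : ℝ) else 1))|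
      ≤ (2 : ℝ) ^ ((1 - δ) * (n : ℝ)) :=
  stub_heSpine stub_hePairing stub_heFourthMoment stub_heEnergyTransport l1Budget stub_heMultEnergyFlat

/-! ### Composition (sorry-free; same assembly as line `Sketch`, fresh names) -/

/-- The DLOG S-box on `n`-bit registers read through `Nat.ofBits`: the crux's indicator vector is
the graph vector of `x ↦ bits (g^{ofBits x} mod p)` because `gˣ mod p < p < 2ⁿ`. -/
theorem indicator_eq_graph (n p g : ℕ) (hp0 : 0 < p) (hpn : p < 2 ^ n) :
    (fun w : QReg (n + n) =>
      if Nat.ofBits (fun j : Fin n => w (Fin.natAdd n j)) =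
          g ^ Nat.ofBits (fun i : Fin n => w (Fin.castAdd n i)) % p then (1 : ℂ) else 0) =
    fun w : QReg (n + n) =>
      if (fun j : Fin n => w (Fin.natAdd n j)) =
          (fun x : QReg n => fun j : Fin n => (g ^ Nat.ofBits x % p).testBit (j : ℕ))
            (fun i : Fin n => w (Fin.castAdd n i)) then (1 : ℂ) else 0 := by
  funext w
  have key : (Nat.ofBits (fun j : Fin n => w (Fin.natAdd n j)) =
        g ^ Nat.ofBits (fun i : Fin n => w (Fin.castAdd n i)) % p) ↔
      ((fun j : Fin n => w (Fin.natAdd n j)) =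
        fun j : Fin n => (g ^ Nat.ofBits (fun i : Fin n => w (Fin.castAdd n i)) % p).testBit (j : ℕ)) := by
    set m := g ^ Nat.ofBits (fun i : Fin n => w (Fin.castAdd n i)) % p with hm
    have hm2 : m < 2 ^ n := (Nat.mod_lt _ hp0).trans hpn
    constructor
    · intro h
      funext j
      have := Nat.testBit_ofBits_lt (fun j : Fin n => w (Fin.natAdd n j)) j.val j.isLt
      rw [h] at this
      simpa using this.symm
    · intro h
      rw [h, Nat.ofBits_testBit, Nat.mod_eq_of_lt hm2]
  by_cases hc : Nat.ofBits (fun j : Fin n => w (Fin.natAdd n j)) =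
      g ^ Nat.ofBits (fun i : Fin n => w (Fin.castAdd n i)) % p
  · rw [if_pos hc, if_pos (key.mp hc)]
  · rw [if_neg hc, if_neg (fun h => hc (key.mpr h))]

/-- Numerical bookkeeping for the flank: for `128 ≤ n` and `δ ≤ 1/64`,
`2^{n − ⌊n/16⌋ + 2} + 2^{n − ⌊n/8⌋ + 2} ≤ 2^{(1−δ)n}`. -/
theorem flankNumerics (n : ℕ) (hn : 128 ≤ n) (δ : ℝ) (hδ : δ ≤ 1 / 64) :
    ((2 ^ (n - n / 16 + 2) + 2 ^ (n - n / 8 + 2) : ℕ) : ℝ) ≤ (2 : ℝ) ^ ((1 - δ) * (n : ℝ)) := by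
  have hA : (2 : ℕ) ^ (n - n / 8 + 2) ≤ 2 ^ (n - n / 16 + 2) :=
    Nat.pow_le_pow_right (by norm_num) (by omega)
  have hsum : ((2 ^ (n - n / 16 + 2) + 2 ^ (n - n / 8 + 2) : ℕ) : ℝ) ≤ (2 : ℝ) ^ ((n - n / 16 + 3 : ℕ) : ℝ) := by
    rw [Real.rpow_natCast]
    have : (2 : ℕ) ^ (n - n / 16 + 2) + 2 ^ (n - n / 8 + 2) ≤ 2 ^ (n - n / 16 + 3) := by
      calc (2 : ℕ) ^ (n - n / 16 + 2) + 2 ^ (n - n / 8 + 2)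
          ≤ 2 ^ (n - n / 16 + 2) + 2 ^ (n - n / 16 + 2) := Nat.add_le_add_left hA _
        _ = 2 ^ (n - n / 16 + 3) := by ring
    exact_mod_cast this
  refine hsum.trans (Real.rpow_le_rpow_of_exponent_le (by norm_num) ?_)
  have hdiv : (16 : ℕ) * (n / 16) + 16 > n := by omega
  have hle : n / 16 ≤ n := Nat.div_le_self _ _
  have hcast : ((n - n / 16 + 3 : ℕ) : ℝ) = (n : ℝ) - ((n / 16 : ℕ) : ℝ) + 3 := by
    rw [Nat.cast_add, Nat.cast_sub hle]
    norm_num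
  rw [hcast]
  have h1 : (16 : ℝ) * ((n / 16 : ℕ) : ℝ) + 16 > (n : ℝ) := by exact_mod_cast hdiv
  have hn' : (128 : ℝ) ≤ n := by exact_mod_cast hn
  nlinarith

/-- Numerical bookkeeping for the range bias: for `128 ≤ n` and `δ ≤ 1/64`,
`2·2^{⌊53n/100⌋} + 2 ≤ 2^{(1−δ)n}`. -/
theorem rangeNumerics (n : ℕ) (hn : 128 ≤ n) (δ : ℝ) (hδ : δ ≤ 1 / 64) :
    (2 : ℝ) * 2 ^ (53 * n / 100) + 2 ≤ (2 : ℝ) ^ ((1 - δ) * (n : ℝ)) := by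
  have hsum : (2 : ℝ) * 2 ^ (53 * n / 100) + 2 ≤ (2 : ℝ) ^ ((53 * n / 100 + 2 : ℕ) : ℝ) := by
    rw [Real.rpow_natCast]
    have h1 : (1 : ℝ) ≤ 2 ^ (53 * n / 100) := one_le_pow₀ (by norm_num)
    have : (2 : ℝ) ^ (53 * n / 100 + 2) = 4 * 2 ^ (53 * n / 100) := by ring
    rw [this]
    linarith
  refine hsum.trans (Real.rpow_le_rpow_of_exponent_le (by norm_num) ?_)
  have hdiv : (100 : ℕ) * (53 * n / 100) ≤ 53 * n := Nat.mul_div_le _ _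
  have h1 : (100 : ℝ) * ((53 * n / 100 : ℕ) : ℝ) ≤ 53 * (n : ℝ) := by exact_mod_cast hdiv
  have hn' : (128 : ℝ) ≤ n := by exact_mod_cast hn
  push_cast
  nlinarith

/-- **Sector A of the crux, unconditional (LANDED chain of line `Sketch`): XOR-differential uniformity
of the DLOG S-box.** Flank (`stub_dlogDiffFlank`) + band (`diffBand`). -/
theorem xorDifferential_flat : ∃ δ : ℝ, 0 < δ ∧ ∃ n₀ : ℕ, ∀ n ≥ n₀, ∀ p g : ℕ, p.Prime →
    p < 2 ^ n → 2 ^ n ≤ p + 2 ^ (53 * n / 100) → orderOf (g : ZMod p) = p - 1 →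
    (∀ c : Fin (n + 1) → ℤ, (∀ i, c i = 0 ∨ c i = 1 ∨ c i = -1) →
      ∑ i, c i * 2 ^ (i : ℕ) = (p : ℤ) - 1 → n ≤ 8 * (Finset.univ.filter fun i => c i ≠ 0).card) →
    ∀ a : QReg n, a ≠ (fun _ => false) → ∀ a' : QReg n,
    ((Finset.univ.filter fun x : QReg n =>
        (fun i : Fin n => Bool.xor ((g ^ Nat.ofBits (fun j => Bool.xor (x j) (a j)) % p).testBit (i : ℕ))
          ((g ^ Nat.ofBits x % p).testBit (i : ℕ))) = a').card : ℝ)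
      ≤ (2 : ℝ) ^ ((1 - δ) * (n : ℝ)) := by
  obtain ⟨δB, hδB, nB, hB⟩ := diffBand
  set δ : ℝ := min δB (1 / 64) with hδdef
  have hδpos : 0 < δ := lt_min hδB (by norm_num)
  have hδB' : δ ≤ δB := min_le_left _ _
  have hδ64 : δ ≤ 1 / 64 := min_le_right _ _
  have hmono : ∀ {δ₁ δ₂ : ℝ} (n : ℕ), δ₂ ≤ δ₁ →
      (2 : ℝ) ^ ((1 - δ₁) * (n : ℝ)) ≤ (2 : ℝ) ^ ((1 - δ₂) * (n : ℝ)) := by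
    intro δ₁ δ₂ n h
    refine Real.rpow_le_rpow_of_exponent_le (by norm_num) ?_
    exact mul_le_mul_of_nonneg_right (by linarith) (Nat.cast_nonneg _)
  refine ⟨δ, hδpos, max nB 128, ?_⟩
  intro n hn p g hp hpn hwin hg hguard a ha b
  have hnB : nB ≤ n := le_trans (le_max_left _ _) hn
  have hn128 : 128 ≤ n := le_trans (le_max_right _ _) hn
  set f : QReg n → QReg n := fun x => fun j : Fin n => (g ^ Nat.ofBits x % p).testBit (j : ℕ) with hf
  change ((Finset.univ.filter fun x : QReg n =>
      (fun i => Bool.xor (f (fun j => Bool.xor (x j) (a j)) i) (f x i)) = b).card : ℝ) ≤ _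
  by_cases hband : n - n / 16 ≤
      min (Finset.univ.filter fun i => a i = true).card
          (n - (Finset.univ.filter fun i => a i = true).card) +
        min (Finset.univ.filter fun j => b j = true).card
          (n - (Finset.univ.filter fun j => b j = true).card) + 3
  · exact (hB n hnB p g hp hpn hwin hg hguard a ha b hband).trans (hmono n hδB')
  · have hflank := stub_dlogDiffFlank n p g hp hpn hwin hg hguard (by omega) a ha b
    push Not at hband
    have hexp : min (Finset.univ.filter fun i => a i = true).card
          (n - (Finset.univ.filter fun i => a i = true).card) +
        min (Finset.univ.filter fun j => b j = true).card
          (n - (Finset.univ.filter fun j => b j = true).card) + 3 ≤ n - n / 16 + 2 := by omega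
    have hnat : (Finset.univ.filter fun x : QReg n =>
        (fun i => Bool.xor (f (fun j => Bool.xor (x j) (a j)) i) (f x i)) = b).card
          ≤ 2 ^ (n - n / 16 + 2) + 2 ^ (n - n / 8 + 2) :=
      hflank.trans (Nat.add_le_add_right (Nat.pow_le_pow_right (by norm_num) hexp) _)
    have hreal : ((Finset.univ.filter fun x : QReg n =>
        (fun i => Bool.xor (f (fun j => Bool.xor (x j) (a j)) i) (f x i)) = b).card : ℝ)
          ≤ ((2 ^ (n - n / 16 + 2) + 2 ^ (n - n / 8 + 2) : ℕ) : ℝ) := by exact_mod_cast hnat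
    exact hreal.trans (flankNumerics n hn128 δ hδ64)

/-- **Composition of line `Sketch_holder_energy`**: the crux from the registered stubs — sector A is
`xorDifferential_flat` (landed chain), `α = 0` is the landed range stub, `α ≠ 0` is `walshTwisted`
(the Hölder-energy spine over the `stub_he*` stubs), assembled by the S-box dictionary
`GraphStateSpectrum_proof`. (The same assembly with the twisted-Walsh statement as a hypothesis is
`work/OfTwisted.lean`, to be landed as an interface.) -/
theorem DlogGraphFlat_of :
    Summit.QuantumAdvantage.QuantumAdvantage.Theses.SymplecticPurity.DlogGraphFlat := by
  unfold Summit.QuantumAdvantage.QuantumAdvantage.Theses.SymplecticPurity.DlogGraphFlat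
  obtain ⟨δB, hδB, nB, hB⟩ := xorDifferential_flat
  obtain ⟨δT, hδT, nT, hT⟩ := walshTwisted
  set δ : ℝ := min (min δB δT) (1 / 64) with hδdef
  have hδpos : 0 < δ := lt_min (lt_min hδB hδT) (by norm_num)
  have hδB' : δ ≤ δB := (min_le_left _ _).trans (min_le_left _ _)
  have hδT' : δ ≤ δT := (min_le_left _ _).trans (min_le_right _ _)
  have hδ64 : δ ≤ 1 / 64 := min_le_right _ _
  have hmono : ∀ {δ₁ δ₂ : ℝ} (n : ℕ), δ₂ ≤ δ₁ →
      (2 : ℝ) ^ ((1 - δ₁) * (n : ℝ)) ≤ (2 : ℝ) ^ ((1 - δ₂) * (n : ℝ)) := by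
    intro δ₁ δ₂ n h
    refine Real.rpow_le_rpow_of_exponent_le (by norm_num) ?_
    exact mul_le_mul_of_nonneg_right (by linarith) (Nat.cast_nonneg _)
  refine ⟨δ, hδpos, max (max nB nT) 128, ?_⟩
  intro n hn p hp hpn hwin g hg hguard S hS
  have hnB : nB ≤ n := le_trans ((le_max_left _ _).trans (le_max_left _ _)) hn
  have hnT : nT ≤ n := le_trans ((le_max_right _ _).trans (le_max_left _ _)) hn
  have hn128 : 128 ≤ n := le_trans (le_max_right _ _) hn
  set f : QReg n → QReg n := fun x => fun j : Fin n => (g ^ Nat.ofBits x % p).testBit (j : ℕ) with hf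
  rw [indicator_eq_graph n p g hp.pos hpn]
  have hD : ∀ a : QReg n, a ≠ (fun _ => false) → ∀ b : QReg n,
      ((Finset.univ.filter fun x : QReg n =>
          (fun i => Bool.xor (f (fun j => Bool.xor (x j) (a j)) i) (f x i)) = b).card : ℝ)
        ≤ (2 : ℝ) ^ ((1 - δ) * (n : ℝ)) := fun a ha b =>
    (hB n hnB p g hp hpn hwin hg hguard a ha b).trans (hmono n hδB')
  have hΛ : ∀ β : QReg n, β ≠ (fun _ => false) → ∀ α : QReg n,
      |∑ x : QReg n, (∏ i, (if α i && x i then (-1 : ℝ) else 1)) *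
          (∏ i, (if β i && f x i then (-1 : ℝ) else 1))| ≤ (2 : ℝ) ^ ((1 - δ) * (n : ℝ)) := by
    intro β hβ α
    by_cases hα : α = fun _ => false
    · subst hα
      have hrange := stub_dlogWalshRange n p g hp hpn hwin hg β hβ
      simp only [Bool.false_and, Bool.false_eq_true, if_false, Finset.prod_const_one, one_mul]
      exact hrange.trans (rangeNumerics n hn128 δ hδ64)
    · exact (hT n hnT p g hp hpn hwin hg hguard β hβ α hα).trans (hmono n hδT')
  have main := GraphStateSpectrum_proof n f _ _ hD hΛ S hS
  rwa [max_self] at main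

end Summit.QuantumAdvantage.QuantumAdvantage.Theorems.SymplecticPurity.HolderEnergy
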